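import Summits.NavierStokesRegularity.NavierStokesRegularity.Theorems.PerpetualPumpAveragedTypeIBlowupHandoffTools
import Summits.NavierStokesRegularity.NavierStokesRegularity.Theorems.PerpetualPumpAveragedTypeIBlowupPulseTrunc
import Summits.NavierStokesRegularity.NavierStokesRegularity.Theorems.PerpetualPumpAveragedTypeIBlowupLevelOneBond

/-!
# Crux `PerpetualPump.AveragedTypeIBlowup` (stmt-NavierStokesRegularity-1835), line `Sketch`:
# stub `handoff` — the transfer pulse read at the argmax time of the next carrier

Third tools file of the proof of the registered stub `stub_handoff` (the hand-off certificate of the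
window one-step theorem; Mathlib-only mathematics). In the abstract setting of the forced Toda gate
`b' = −b − w² + f₁`, `w' = w(b − β − 1) + f₂`, `β' = −q⁴β + w² + f₃` (`|fᵢ| ≤ 1/2000`, `b(0) = B ≥ 10⁴`,
`w(0) = √B/10`, `|β(0)| ≤ 1/50`) on the pulse horizon `σ_P = (5 log B + 20)/B`, coupled to the next
bond `y' = q⁴(y(qβ − x₂/q − 1) + ε̄q²β²) + e_y` with its Duhamel majorant, the theorem
`handoff_pulseFacts` collects what the hand-off needs at the argmax time `σ_e` of `β`:

* the outputs of the full pulse `stub_pulse` (location of `σ_e`, the level `β(σ_e) ∈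
  [B − 6 log B − 30, B + 1]`, the old bond `w(σ_e)² = q⁴β(σ_e) ± 1/2000`, the old carrier
  `b(σ_e) = 1/2 ± 1/20`, `w ≥ 1` up to `σ_e`, the a-priori box) and the energy corridor of
  `stub_pulseEnvelope`;
* the POSITIVITY of the next bond at `σ_e`: the rise of `β` from `B/4` (first passage `σ_h`, rise
  budget `∫₀^{σ_h}|β| ≤ 1` by `stub_pulseRise`) keeps `β ≥ (B+1)/5` on a window of length
  `1/(2(B+1))` before `σ_e` (barrier and mean-value arguments), so `stub_levelOneBond` (ii) applies;
* the size of the next bond and of its majorant at `σ_e` (`stub_levelOneBond` (i) with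
  `Λ = 2 log B + 10`).

The registered tools sub-goal `stub_handoffPulse` is the monotonicity of `∫₀^σ |β|` in `σ`.

## References

T. Tao, *Finite time blowup for an averaged three-dimensional Navier–Stokes equation*, J. Amer.
Math. Soc. 29 (2016), §5.4–5.5 (the transfer step of the cascade); folklore ODE arguments.
-/

noncomputable section

-- the summit namespace `…NavierStokesRegularity.NavierStokesRegularity…` is the tree convention
set_option linter.dupNamespace false

open Set MeasureTheory Filter Topology intervalIntegral

namespace Summit.NavierStokesRegularity.NavierStokesRegularity.Theorems.PerpetualPumpAveragedTypeIBlowup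


/-- **Monotonicity of the amplification budget**: for a function `β` continuous on `[0, S]` and
`0 ≤ σ ≤ σ' ≤ S`, `∫₀^σ |β| ≤ ∫₀^{σ'} |β|`. [folklore] -/
theorem handoff_absIntegral_mono {β : ℝ → ℝ} {S σ σ' : ℝ} (hβ : ContinuousOn β (Icc 0 S))
    (hσ : 0 ≤ σ) (hσσ' : σ ≤ σ') (hσ' : σ' ≤ S) :
    ∫ u in (0 : ℝ)..σ, |β u| ≤ ∫ u in (0 : ℝ)..σ', |β u| := by
  have hc : ContinuousOn (fun u => |β u|) (Icc 0 σ') :=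
    (continuous_abs.comp_continuousOn hβ).mono (Icc_subset_Icc_right hσ')
  exact intervalIntegral.integral_mono_interval le_rfl hσ hσσ'
    (Filter.Eventually.of_forall fun u => abs_nonneg _) (hc.intervalIntegrable_of_Icc (hσ.trans hσσ'))

/-- **Registered tools sub-goal `stub_handoffPulse`** of the stub `handoff` (line `Sketch`, crux
stmt-NavierStokesRegularity-1835): monotonicity of `σ ↦ ∫₀^σ |β|` for a continuous `β`
(`handoff_absIntegral_mono`). [folklore] -/
theorem stub_handoffPulse :
    ∀ (β : ℝ → ℝ) (S σ σ' : ℝ), ContinuousOn β (Icc 0 S) → 0 ≤ σ → σ ≤ σ' → σ' ≤ S →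
      ∫ u in (0 : ℝ)..σ, |β u| ≤ ∫ u in (0 : ℝ)..σ', |β u| :=
  fun _ _ _ _ hβ hσ hσσ' hσ' => handoff_absIntegral_mono hβ hσ hσσ' hσ'

/-- **The transfer pulse read at the argmax time of the next carrier.** See the module docstring:
the outputs of `stub_pulse` and `stub_pulseEnvelope`, the positivity of the next bond at `σ_e`
(`stub_pulseRise` + a barrier on the rise window + `stub_levelOneBond` (ii)) and the size of the next
bond and of its majorant there (`stub_levelOneBond` (i), `Λ = 2 log B + 10`). [folklore] -/
theorem handoff_pulseFacts :
    ∀ (b w β f₁ f₂ f₃ y my x2 ey : ℝ → ℝ) (B q θ η εb σP : ℝ),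
      10 ^ 4 ≤ B → 1 ≤ q → q ≤ 21 / 20 → q ^ 4 ≤ 111 / 100 → 1 / 2 ≤ θ → θ ≤ 1 → 0 ≤ η → 0 < εb →
      εb * q ^ 2 * (B + 1) ^ 2 ≤ 1 → η * (q * (B + 1) + 1) ^ 3 ≤ 1 / 10 ^ 6 →
      σP = (5 * Real.log B + 20) / B →
      ContinuousOn b (Icc 0 σP) → ContinuousOn w (Icc 0 σP) → ContinuousOn β (Icc 0 σP) →
      ContinuousOn f₁ (Icc 0 σP) → ContinuousOn f₂ (Icc 0 σP) → ContinuousOn f₃ (Icc 0 σP) →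
      (∀ σ ∈ Ioo 0 σP, HasDerivAt b (-(b σ) - (w σ) ^ 2 + f₁ σ) σ) →
      (∀ σ ∈ Ioo 0 σP, HasDerivAt w (w σ * (b σ - β σ - 1) + f₂ σ) σ) →
      (∀ σ ∈ Ioo 0 σP, HasDerivAt β (-(q ^ 4 * β σ) + (w σ) ^ 2 + f₃ σ) σ) →
      (∀ σ ∈ Icc 0 σP, |f₁ σ| ≤ 1 / 2000 ∧ |f₂ σ| ≤ 1 / 2000 ∧ |f₃ σ| ≤ 1 / 2000) →
      b 0 = B → w 0 = Real.sqrt B / 10 → |β 0| ≤ 1 / 50 →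
      ContinuousOn y (Icc 0 σP) → ContinuousOn my (Icc 0 σP) → ContinuousOn x2 (Icc 0 σP) →
      ContinuousOn ey (Icc 0 σP) →
      (∀ σ ∈ Ioo 0 σP, HasDerivAt y
        (q ^ 4 * (y σ * (q * β σ - x2 σ / q - 1) + εb * q ^ 2 * (β σ) ^ 2) + ey σ) σ) →
      (∀ σ ∈ Icc 0 σP, |ey σ| ≤ η * q ^ 4 * my σ) →
      (∀ σ ∈ Icc 0 σP, 0 ≤ my σ ∧ my σ ≤ my 0 * Real.exp (-(θ * q ^ 4 * σ)) +
        q ^ 4 * ∫ u in (0 : ℝ)..σ, Real.exp (-(θ * q ^ 4 * (σ - u))) *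
          |y u * (q * β u - x2 u / q) + εb * q ^ 2 * (β u) ^ 2|) →
      (∀ σ ∈ Icc 0 σP, |x2 σ| ≤ 1 / 2) → |y 0| ≤ 11 / 10 * εb → my 0 ≤ 4 * εb →
      ∃ σe ∈ Ioo 0 σP,
        (∀ σ ∈ Icc 0 σP, β σ ≤ β σe) ∧
        B - 6 * Real.log B - 30 ≤ β σe ∧ β σe ≤ B + 1 ∧
        |(w σe) ^ 2 - q ^ 4 * β σe| ≤ 1 / 2000 ∧ |b σe - 1 / 2| ≤ 1 / 20 ∧
        (∀ σ ∈ Icc 0 σe, 1 ≤ w σ) ∧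
        (∀ σ ∈ Icc 0 σP, -(1 / 2) ≤ b σ ∧ b σ ≤ B + 1 ∧ |w σ| ≤ B ∧ -(1 / 50) ≤ β σ ∧ β σ ≤ B + 1) ∧
        (∀ σ ∈ Icc 0 σP, B - 1 / 50 - 1111 / 1000 * B * σ ≤ b σ + β σ) ∧
        0 < y σe ∧
        |y σe| ≤ Real.exp (q ^ 5 * (2 * Real.log B + 10)) *
          (11 / 10 * εb + 3 * εb * q ^ 2 * (B + 1) ^ 2 * σe) ∧
        my σe ≤ 4 * εb + 2 * ((q * (B + 1) + 1) * Real.exp (q ^ 5 * (2 * Real.log B + 10)) *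
          (11 / 10 * εb + 3 * εb * q ^ 2 * (B + 1) ^ 2 * σe) + εb * q ^ 2 * (B + 1) ^ 2) ∧
        σP ≤ 1 / 10 ∧ B * σP = 5 * Real.log B + 20 := by
  intro b w β f₁ f₂ f₃ y my x2 ey B q θ η εb σP hB hq1 hq2 hq4 hθ1 hθ2 hη hεb hεbP hηP hσP
    hbc hwc hβc hf1c hf2c hf3c hbd hwd hβd hf hb0 hw0 hβ0 hyc hmyc hx2c heyc hyd hey hmy hx2 hy0 hmy0
  have hB0 : 0 < B := lt_of_lt_of_le (by norm_num) hB
  have hq0 : 0 < q := by linarith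
  have hq41 : 1 ≤ q ^ 4 := one_le_pow₀ hq1
  obtain ⟨hσP10, hσP0, -, hBσP, hlog0, hlogle⟩ := handoff_sigmaP_le hB
  rw [← hσP] at hσP10 hσP0 hBσP
  have hφ0 : (0 : ℝ) ≤ 1 / 2000 := by norm_num
  -- the full pulse
  obtain ⟨σe, hσe, hmax, hβlo, hβhi, hwsq, hbhalf, -, hIβ, hw1, hlast⟩ :=
    stub_pulse b w β f₁ f₂ f₃ B (q ^ 4) (1 / 2000) σP hB hq41 hq4 hφ0 le_rfl (le_of_eq hσP.symm)
      hσP10 hbc hwc hβc hf1c hf2c hf3c hbd hwd hβd hf hb0 hw0 hβ0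
  have henv : ∀ σ ∈ Icc 0 σP, B - 1 / 50 - 1111 / 1000 * B * σ ≤ b σ + β σ := fun σ hσ =>
    (stub_pulseEnvelope b w β f₁ f₂ f₃ B (q ^ 4) (1 / 2000) σP hB hq41 hq4 hφ0 le_rfl hσP10 hbc hwc
      hβc hbd hwd hβd hf hb0 hw0 hβ0 σ hσ).2.2.2.2.2
  have hrise := stub_pulseRise b w β f₁ f₂ f₃ B (q ^ 4) (1 / 2000) σP hB hq41 hq4 hφ0 le_rfl hσP10
    hbc hwc hβc hbd hwd hβd hf hb0 hw0 hβ0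
  -- the level at the argmax time
  have hL := pulse_log_le hB
  have hβe99 : 99 / 100 * B ≤ β σe := by linarith
  obtain ⟨hwinlo, hclimb, hδ0, h50, h34⟩ := handoff_rise_numeric (q4 := q ^ 4) hB hq4
  set P := B + 1 with hP
  set δ := 1 / (2 * (B + 1)) with hδ
  -- the first passage of β through B/4 before σe
  have hβ0' : β 0 ≤ B / 4 := le_trans (le_trans (le_abs_self _) hβ0) h50
  obtain ⟨σh, hσh, hβσh, hbefore⟩ := ivtNesting_exists_first_eq (f := β) hσe.1.le
    (hβc.mono (Icc_subset_Icc_right hσe.2.le)) hβ0' (by linarith)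
  have hσhP : σh ∈ Icc 0 σP := ⟨hσh.1, hσh.2.trans hσe.2.le⟩
  have hIσh : ∫ u in (0 : ℝ)..σh, |β u| ≤ 1 := by
    refine hrise σh hσhP fun u hu => ?_
    rcases hu.2.eq_or_lt with h | h
    · rw [h, hβσh]
    · exact (hbefore u ⟨hu.1, h⟩).le
  -- the rise window [σh, σh + δ] lies before σe
  have hq40 : 0 ≤ q ^ 4 := by positivity
  have hwin : σh + δ ≤ σe := by
    by_contra hlt
    push Not at hlt
    have hder : ∀ x ∈ Ioo σh σe, ∃ f' : ℝ, HasDerivAt β f' x ∧ f' ≤ B ^ 2 + q ^ 4 / 50 + 1 / 2000 := by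
      intro x hx
      have hxP : x ∈ Icc 0 σP := ⟨hσh.1.trans hx.1.le, (hx.2.trans hσe.2).le⟩
      obtain ⟨-, -, hwx, hβx, -⟩ := hlast x hxP
      refine ⟨_, hβd x ⟨hσh.1.trans_lt hx.1, hx.2.trans hσe.2⟩, ?_⟩
      have h1 : (w x) ^ 2 ≤ B ^ 2 := by
        have h := pow_le_pow_left₀ (abs_nonneg _) hwx 2
        rwa [sq_abs] at h
      have h2 : q ^ 4 * (-(1 / 50)) ≤ q ^ 4 * β x := mul_le_mul_of_nonneg_left hβx hq40
      have h3 := (abs_le.1 (hf x hxP).2.2).2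
      linarith only [h1, h2, h3]
    have hmvt := logisticClock_image_sub_le (f := β) (C := B ^ 2 + q ^ 4 / 50 + 1 / 2000) hσh.2
      (hβc.mono (Icc_subset_Icc hσh.1 hσe.2.le)) hder
    have hC0 : 0 ≤ B ^ 2 + q ^ 4 / 50 + 1 / 2000 := by positivity
    have h1 : (B ^ 2 + q ^ 4 / 50 + 1 / 2000) * (σe - σh) ≤ (B ^ 2 + q ^ 4 / 50 + 1 / 2000) * δ :=
      mul_le_mul_of_nonneg_left (by linarith only [hlt]) hC0
    linarith only [hmvt, h1, hclimb, hβσh, hβe99, h34]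
  have hwinP : σh + δ ≤ σP := hwin.trans hσe.2.le
  -- on the rise window the carrier stays above P/5 (barrier for β + K(u - σh))
  have hβwin : ∀ u ∈ Icc σh (σh + δ), P / 5 ≤ β u := by
    set K := q ^ 4 * (B / 4) + 1 / 2000 + 1 with hK
    have hK0 : 0 ≤ K := by positivity
    have hxc : ContinuousOn (fun u => β u + K * (u - σh)) (Icc σh (σh + δ)) :=
      (hβc.mono (Icc_subset_Icc hσh.1 hwinP)).add (Continuous.continuousOn (by fun_prop))
    have hx0 : B / 4 ≤ β σh + K * (σh - σh) := by rw [sub_self, mul_zero, add_zero, hβσh]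
    have hder : ∀ s ∈ Ioo σh (σh + δ), β s + K * (s - σh) < B / 4 →
        ∃ x' : ℝ, HasDerivAt (fun u => β u + K * (u - σh)) x' s ∧ 0 < x' := by
      intro s hs hlt
      have hsP : s ∈ Icc 0 σP := ⟨hσh.1.trans hs.1.le, hs.2.le.trans hwinP⟩
      have hsO : s ∈ Ioo 0 σP := ⟨hσh.1.trans_lt hs.1, hs.2.trans_le hwinP⟩
      have hKs : 0 ≤ K * (s - σh) := mul_nonneg hK0 (by linarith only [hs.1])
      have hβs4 : β s ≤ B / 4 := by linarith only [hlt, hKs]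
      refine ⟨_, (hβd s hsO).add (((hasDerivAt_id s).sub_const σh).const_mul K), ?_⟩
      have h1 : q ^ 4 * β s ≤ q ^ 4 * (B / 4) := mul_le_mul_of_nonneg_left hβs4 hq40
      have h2 := (abs_le.1 (hf s hsP).2.2).1
      have h3 : 0 ≤ (w s) ^ 2 := sq_nonneg _
      rw [mul_one, hK]
      linarith only [h1, h2, h3]
    have hbar := pulse_barrier_lower hxc hx0 hder
    intro u hu
    have h1 := hbar u hu
    have h2 : K * (u - σh) ≤ K * δ := mul_le_mul_of_nonneg_left (by linarith only [hu.2]) hK0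
    have h3 : (B + 1) / 5 ≤ B / 4 - K * δ := hwinlo
    linarith only [h1, h2, h3]
  -- the next bond: stub_levelOneBond on [0, σe]
  have hσe0 : 0 ≤ σe := hσe.1.le
  have hσe10 : σe ≤ 1 / 10 := hσe.2.le.trans hσP10
  have hsub : Icc 0 σe ⊆ Icc 0 σP := Icc_subset_Icc_right hσe.2.le
  have hsubo : Ioo 0 σe ⊆ Ioo 0 σP := Ioo_subset_Ioo_right hσe.2.le
  have hΛ0 : 0 ≤ 2 * Real.log B + 10 := by linarith
  obtain ⟨hi, hii⟩ := stub_levelOneBond y β x2 my ey q θ η εb (B + 1) (2 * Real.log B + 10)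
    (11 / 10 * εb) σe hq1 hq2 hθ1 hθ2 hη hεb (by linarith) hεbP hηP hΛ0 (by positivity) (by linarith)
    hσe0 hσe10 (hyc.mono hsub) (hβc.mono hsub) (hx2c.mono hsub) (hmyc.mono hsub) (heyc.mono hsub)
    (fun σ hσ => hyd σ (hsubo hσ)) (fun σ hσ => hey σ (hsub hσ)) (fun σ hσ => hmy σ (hsub hσ))
    (fun σ hσ => ⟨(hlast σ (hsub hσ)).2.2.2.1, (hlast σ (hsub hσ)).2.2.2.2⟩)
    (fun σ hσ => (handoff_absIntegral_mono hβc hσ.1 hσ.2 hσe.2.le).trans hIβ)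
    (fun σ hσ => hx2 σ (hsub hσ)) hy0 hmy0
  obtain ⟨hyabs, hmyle⟩ := hi σe ⟨hσe0, le_rfl⟩
  have hypos : 0 < y σe := hii σh hσh hwin hIσh hβwin σe ⟨hwin, le_rfl⟩
  exact ⟨σe, hσe, hmax, hβlo, hβhi, hwsq, hbhalf, hw1, hlast, henv, hypos, hyabs, hmyle, hσP10, hBσP⟩

end Summit.NavierStokesRegularity.NavierStokesRegularity.Theorems.PerpetualPumpAveragedTypeIBlowup

end
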